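import Summits.NavierStokesRegularity.FunctionalMining.VorticityL4CZ
import Summits.NavierStokesRegularity.FunctionalMining.VelocityL4SaturatingLaw

/-!
# FunctionalMining — K0 row `E.q=4|T_LD|G1` HOLDS (∃κ): the `Z₄ = ∫|ω|⁴` saturating law in the kernel

Search for candidate a priori estimates; no regularity claim.

The no-go seat's Theorem G (SIEVELD §3.2) settles the rows `E.q|T_LD|G1` on paper: along every
zero-mean classical solution of unforced Navier–Stokes on `T³`,
`d/dt Z_q ≤ κ ν^{−γ} (2ℰ) Z_q^{1+1/σ}`, `σ = 2q−3`, `γ = (3q−3)/(2q−3)`. This file proves the row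
`q = 4` (`σ = 5`, `γ = 9/5`) as a theorem on `T³ = UnitAddTorus (Fin 3)`:
`∃ κ, SaturatingLaw (d := Fin 3) (torusVorticityMoment 4) 5 (9/5) κ`.

Chain (every input a tree theorem; Cauchy–Schwarz only, no fractional Hölder): with
`ω = curl u` (smooth, zero-mean), `A_n = ∫‖ω‖ⁿ`, `Z = A₂ = 2ℰ`, `I = ∫‖ω‖²∑ₖ‖∂ₖω‖²`,
`g = ∑ₖ‖∂ₖu‖²`, `X = ∫|ω|²σ`, `J = ∫|ω|²g²`, `G₄ = ∫g⁴`: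
the exact balance (`hasDerivWithinAt_integral_torusVorticitySqAt_pow`, `m = 2`; Gibbon 2010 App. A)
gives `Ż₄ ≤ 4X − 4νI` (`VorticityL4.viscous_term_eq`); `X² ≤ 2A₄J`, `J² ≤ A₄G₄`
(`VorticityL4Pointwise`); `G₄ ≤ K A₈` (Calderón–Zygmund at `s = 8`, `VorticityL4CZ`);
`A₈² ≤ A₄A₁₂`, `A₄⁵ ≤ Z⁴A₁₂` (Cauchy–Schwarz); `A₁₂ ≤ C I³` (the explicit nonlinear Poincaré
inequality and mean-zero Sobolev, `VelocityL4.integral_norm_pow_twelve_le` applied to `ω`). Hence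
`X¹⁴ ≤ K' A₄⁶ Z⁵ I⁹`, and Young at the weights `(9/14, 5/14)` absorbs `I⁹` into `−4νI`.

## Main statements

* `integral_norm_pow_four_pow_five_le` — `A₄⁵ ≤ Z⁴ A₁₂` (Cauchy–Schwarz).
* `production_pow_fourteen_le`, `le_of_pow_fourteen_le` — exponent bookkeeping and Young.
* `production_bound` — `|X|¹⁴ ≤ K A₄⁶ Z⁵ I⁹` on `T³`.
* `derivWithin_Z4_le` — the slice form of the `Z₄` balance, `Ż₄ ≤ 4X − 4νI`.
* `vorticityL4_saturatingLaw` — the row.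
-/

noncomputable section

open MeasureTheory Finset Set
open scoped InnerProductSpace RealInnerProductSpace ContDiff

namespace Summit.NavierStokesRegularity.FunctionalMining

open Literature.Analysis.FunctionSpaces Literature.Analysis.FunctionSpaces.Torus
  Literature.Analysis.FluidPDE

namespace VorticityL4

variable {d : Type*} [Fintype d] [DecidableEq d]

/-! ## 1. One more Cauchy–Schwarz interpolation: `A₄⁵ ≤ Z⁴ A₁₂` -/

omit [DecidableEq d] in
/-- `(∫‖u‖⁴)² ≤ (∫‖u‖²)(∫‖u‖⁶)` (Cauchy–Schwarz). [folklore] -/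
theorem integral_norm_pow_four_sq_le {u : UnitAddTorus d → EuclideanSpace ℝ d} (hu : Continuous u) :
    (∫ x, ‖u x‖ ^ 4) ^ 2 ≤ (∫ x, ‖u x‖ ^ 2) * ∫ x, ‖u x‖ ^ 6 := by
  have h := sq_integral_mul_le (f := fun x => ‖u x‖) (g := fun x => ‖u x‖ ^ 3) hu.norm
    (hu.norm.pow 3)
  have e1 : ∫ x, ‖u x‖ * ‖u x‖ ^ 3 = ∫ x, ‖u x‖ ^ 4 :=
    integral_congr_ae (ae_of_all _ fun x => by ring)
  have e2 : ∫ x, (‖u x‖ ^ 3) ^ 2 = ∫ x, ‖u x‖ ^ 6 :=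
    integral_congr_ae (ae_of_all _ fun x => by ring)
  rw [e1, e2] at h
  exact h

omit [DecidableEq d] in
/-- **`(∫‖u‖⁴)⁵ ≤ (∫‖u‖²)⁴ ∫‖u‖¹²`** (three Cauchy–Schwarz steps: `A₄² ≤ ZA₆`, `A₆⁴ ≤ A₄³A₁₂`).
[ours; elementary] -/
theorem integral_norm_pow_four_pow_five_le {u : UnitAddTorus d → EuclideanSpace ℝ d}
    (hu : Continuous u) :
    (∫ x, ‖u x‖ ^ 4) ^ 5 ≤ (∫ x, ‖u x‖ ^ 2) ^ 4 * ∫ x, ‖u x‖ ^ 12 := by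
  have h1 := integral_norm_pow_four_sq_le hu
  have h2 := VelocityL4.integral_norm_pow_six_pow_four_le hu
  have hZ : 0 ≤ ∫ x, ‖u x‖ ^ 2 := integral_nonneg fun x => by positivity
  have h4 : 0 ≤ ∫ x, ‖u x‖ ^ 4 := integral_nonneg fun x => by positivity
  have h6 : 0 ≤ ∫ x, ‖u x‖ ^ 6 := integral_nonneg fun x => by positivity
  have h12 : 0 ≤ ∫ x, ‖u x‖ ^ 12 := integral_nonneg fun x => by positivity
  set Z := ∫ x, ‖u x‖ ^ 2
  set A := ∫ x, ‖u x‖ ^ 4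
  set B := ∫ x, ‖u x‖ ^ 6
  set C := ∫ x, ‖u x‖ ^ 12
  -- `A⁸ ≤ Z⁴ B⁴ ≤ Z⁴ A³ C`
  have h8 : A ^ 8 ≤ Z ^ 4 * (A ^ 3 * C) := by
    have := pow_le_pow_left₀ (by positivity) h1 4
    calc A ^ 8 = (A ^ 2) ^ 4 := by ring
      _ ≤ (Z * B) ^ 4 := this
      _ = Z ^ 4 * B ^ 4 := by ring
      _ ≤ Z ^ 4 * (A ^ 3 * C) := mul_le_mul_of_nonneg_left h2 (by positivity)
  rcases eq_or_lt_of_le h4 with hA0 | hApos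
  · rw [← hA0]; simp only [ne_eq, OfNat.ofNat_ne_zero, not_false_eq_true, zero_pow]; positivity
  · have hA3 : 0 < A ^ 3 := pow_pos hApos 3
    have : A ^ 5 * A ^ 3 ≤ Z ^ 4 * C * A ^ 3 := by
      calc A ^ 5 * A ^ 3 = A ^ 8 := by ring
        _ ≤ Z ^ 4 * (A ^ 3 * C) := h8
        _ = Z ^ 4 * C * A ^ 3 := by ring
    exact le_of_mul_le_mul_right this hA3

/-! ## 2. Real arithmetic: exponent bookkeeping and Young -/

omit [Fintype d] [DecidableEq d] in
/-- **Exponent bookkeeping (`q = 4`).** From `X² ≤ 2A₄J`, `J² ≤ A₄G₄`, `G₄ ≤ c₁A₈`, `A₈² ≤ A₄A₁₂`,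
`A₄⁵ ≤ Z⁴A₁₂`, `A₁₂ ≤ c₂I³` (all quantities non-negative):
`X¹⁴ ≤ 256 (c₁+1)⁴ (c₂+1)³ · A₄⁶ Z⁵ I⁹`. [ours; elementary] -/
theorem production_pow_fourteen_le {X A₄ J G₄ A₈ A₁₂ Z I c₁ c₂ : ℝ} (hA₄ : 0 ≤ A₄)
    (hG : 0 ≤ G₄) (hA₁₂ : 0 ≤ A₁₂) (hZ : 0 ≤ Z) (hI : 0 ≤ I) (hc₁ : 0 ≤ c₁) (hc₂ : 0 ≤ c₂)
    (h1 : X ^ 2 ≤ 2 * A₄ * J) (h2 : J ^ 2 ≤ A₄ * G₄) (h3 : G₄ ≤ c₁ * A₈)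
    (h4 : A₈ ^ 2 ≤ A₄ * A₁₂) (h5 : A₄ ^ 5 ≤ Z ^ 4 * A₁₂) (h6 : A₁₂ ≤ c₂ * I ^ 3) :
    X ^ 14 ≤ 256 * (c₁ + 1) ^ 4 * (c₂ + 1) ^ 3 * A₄ ^ 6 * Z ^ 5 * I ^ 9 := by
  -- `X⁸ ≤ 16 c₁² A₄⁷ A₁₂`
  have hX8 : X ^ 8 ≤ 16 * c₁ ^ 2 * A₄ ^ 7 * A₁₂ := by
    have e1 : X ^ 8 = (X ^ 2) ^ 4 := by ring
    have s1 : (X ^ 2) ^ 4 ≤ (2 * A₄ * J) ^ 4 := pow_le_pow_left₀ (by positivity) h1 4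
    have s2 : (J ^ 2) ^ 2 ≤ (A₄ * G₄) ^ 2 := pow_le_pow_left₀ (by positivity) h2 2
    have s3 : G₄ ^ 2 ≤ (c₁ * A₈) ^ 2 := pow_le_pow_left₀ hG h3 2
    calc X ^ 8 = (X ^ 2) ^ 4 := e1
      _ ≤ (2 * A₄ * J) ^ 4 := s1
      _ = 16 * A₄ ^ 4 * (J ^ 2) ^ 2 := by ring
      _ ≤ 16 * A₄ ^ 4 * (A₄ * G₄) ^ 2 := by gcongr
      _ = 16 * A₄ ^ 6 * G₄ ^ 2 := by ring
      _ ≤ 16 * A₄ ^ 6 * (c₁ * A₈) ^ 2 := by gcongr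
      _ = 16 * c₁ ^ 2 * A₄ ^ 6 * A₈ ^ 2 := by ring
      _ ≤ 16 * c₁ ^ 2 * A₄ ^ 6 * (A₄ * A₁₂) := by gcongr
      _ = 16 * c₁ ^ 2 * A₄ ^ 7 * A₁₂ := by ring
  -- `X⁵⁶ ≤ 16⁷ c₁¹⁴ A₄²⁴ Z²⁰ A₁₂¹² ≤ 16⁷ c₁¹⁴ c₂¹² A₄²⁴ Z²⁰ I³⁶`
  have hX56 : X ^ 56 ≤ 16 ^ 7 * c₁ ^ 14 * c₂ ^ 12 * A₄ ^ 24 * Z ^ 20 * I ^ 36 := by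
    have s1 : (X ^ 8) ^ 7 ≤ (16 * c₁ ^ 2 * A₄ ^ 7 * A₁₂) ^ 7 := pow_le_pow_left₀ (by positivity) hX8 7
    have s2 : (A₄ ^ 5) ^ 5 ≤ (Z ^ 4 * A₁₂) ^ 5 := pow_le_pow_left₀ (by positivity) h5 5
    have s3 : A₁₂ ^ 12 ≤ (c₂ * I ^ 3) ^ 12 := pow_le_pow_left₀ hA₁₂ h6 12
    calc X ^ 56 = (X ^ 8) ^ 7 := by ring
      _ ≤ (16 * c₁ ^ 2 * A₄ ^ 7 * A₁₂) ^ 7 := s1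
      _ = 16 ^ 7 * c₁ ^ 14 * A₄ ^ 24 * (A₄ ^ 5) ^ 5 * A₁₂ ^ 7 := by ring
      _ ≤ 16 ^ 7 * c₁ ^ 14 * A₄ ^ 24 * (Z ^ 4 * A₁₂) ^ 5 * A₁₂ ^ 7 := by gcongr
      _ = 16 ^ 7 * c₁ ^ 14 * A₄ ^ 24 * Z ^ 20 * A₁₂ ^ 12 := by ring
      _ ≤ 16 ^ 7 * c₁ ^ 14 * A₄ ^ 24 * Z ^ 20 * (c₂ * I ^ 3) ^ 12 := by gcongr
      _ = 16 ^ 7 * c₁ ^ 14 * c₂ ^ 12 * A₄ ^ 24 * Z ^ 20 * I ^ 36 := by ring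
  -- compare with `(K A₄⁶ Z⁵ I⁹)⁴`, `K = 256 (c₁+1)⁴ (c₂+1)³`
  set K : ℝ := 256 * (c₁ + 1) ^ 4 * (c₂ + 1) ^ 3 with hK
  have hc₁' : c₁ ^ 14 ≤ (c₁ + 1) ^ 16 := by
    calc c₁ ^ 14 = c₁ ^ 14 * 1 := by ring
      _ ≤ (c₁ + 1) ^ 14 * (c₁ + 1) ^ 2 := by
          apply mul_le_mul (pow_le_pow_left₀ hc₁ (by linarith) 14) _ zero_le_one (by positivity)
          nlinarith
      _ = (c₁ + 1) ^ 16 := by ring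
  have hc₂' : c₂ ^ 12 ≤ (c₂ + 1) ^ 12 := pow_le_pow_left₀ hc₂ (by linarith) 12
  have h4th : X ^ 56 ≤ (K * A₄ ^ 6 * Z ^ 5 * I ^ 9) ^ 4 := by
    calc X ^ 56 ≤ 16 ^ 7 * c₁ ^ 14 * c₂ ^ 12 * A₄ ^ 24 * Z ^ 20 * I ^ 36 := hX56
      _ ≤ 16 ^ 8 * (c₁ + 1) ^ 16 * (c₂ + 1) ^ 12 * A₄ ^ 24 * Z ^ 20 * I ^ 36 := by
          gcongr <;> norm_num
      _ = (K * A₄ ^ 6 * Z ^ 5 * I ^ 9) ^ 4 := by rw [hK]; ring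
  have e : X ^ 56 = (X ^ 14) ^ 4 := by ring
  rw [e] at h4th
  exact le_of_pow_le_pow_left₀ (by norm_num) (by positivity) h4th

omit [Fintype d] [DecidableEq d] in
/-- **Young / AM–GM at the weights `(9/14, 5/14)`**: `N¹⁴ ≤ x⁹ y⁵` with `N, x, y ≥ 0` gives
`N ≤ (9/14) x + (5/14) y`. [folklore] -/
theorem le_of_pow_fourteen_le {N x y : ℝ} (hN : 0 ≤ N) (hx : 0 ≤ x) (hy : 0 ≤ y)
    (h : N ^ 14 ≤ x ^ 9 * y ^ 5) : N ≤ 9 / 14 * x + 5 / 14 * y := by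
  have h14 : N = (N ^ 14) ^ ((14 : ℕ)⁻¹ : ℝ) := (Real.pow_rpow_inv_natCast hN (by norm_num)).symm
  have hmono : (N ^ 14) ^ ((14 : ℕ)⁻¹ : ℝ) ≤ (x ^ 9 * y ^ 5) ^ ((14 : ℕ)⁻¹ : ℝ) :=
    Real.rpow_le_rpow (by positivity) h (by norm_num)
  have hsplit : (x ^ 9 * y ^ 5) ^ ((14 : ℕ)⁻¹ : ℝ) = x ^ (9 / 14 : ℝ) * y ^ (5 / 14 : ℝ) := by
    rw [Real.mul_rpow (by positivity) (by positivity)]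
    congr 1
    · rw [show x ^ 9 = x ^ ((9 : ℕ) : ℝ) from (Real.rpow_natCast x 9).symm, ← Real.rpow_mul hx]
      norm_num
    · rw [show y ^ 5 = y ^ ((5 : ℕ) : ℝ) from (Real.rpow_natCast y 5).symm, ← Real.rpow_mul hy]
      norm_num
  have hAG : x ^ (9 / 14 : ℝ) * y ^ (5 / 14 : ℝ) ≤ (9 / 14) * x + (5 / 14) * y :=
    Real.geom_mean_le_arith_mean2_weighted (by norm_num) (by norm_num) hx hy (by norm_num)
  rw [h14]
  exact hmono.trans (hsplit.le.trans hAG)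

/-! ## 3. The static production bound on `T³` -/

/-- **Production bound (static, `T³`).** With the tree's constants `C₆` (mean-zero Sobolev) and
`K` (Calderón–Zygmund at `s = 8`): for every smooth divergence-free `v` on `T³`, with `ω = curl v`,
`|∫|ω|²σ|¹⁴ ≤ 256(K+1)⁴(C₁₂+1)³ · (∫‖ω‖⁴)⁶ (∫‖ω‖²)⁵ (∫‖ω‖²∑ₖ‖∂ₖω‖²)⁹`,
`C₁₂ = 32(64C₆ + (1968·27)³)`. [ours] -/
theorem production_bound {C₆ K : ℝ} (hC₆0 : 0 ≤ C₆) (hK0 : 0 ≤ K)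
    (hC₆ : ∀ w : UnitAddTorus (Fin 3) → EuclideanSpace ℝ (Fin 3), IsSmooth w → HasZeroMean w →
      ∫ x, ‖w x‖ ^ 6 ≤ C₆ * gradNormSq w ^ 3)
    (hK : ∀ w : UnitAddTorus (Fin 3) → EuclideanSpace ℝ (Fin 3), IsSmooth w → IsDivFree w →
      ∫ x, (∑ k, ‖partialDeriv k w x‖ ^ 2) ^ 4 ≤ K * ∫ x, ‖BDSV.curl w x‖ ^ 8)
    {v : UnitAddTorus (Fin 3) → EuclideanSpace ℝ (Fin 3)} (hv : IsSmooth v) (hdiv : IsDivFree v) :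
    |∫ x, torusVorticitySqAt v x * torusStretchingDensity v x| ^ 14 ≤
      256 * (K + 1) ^ 4 * (32 * (64 * C₆ + (1968 * (3 : ℝ) ^ 3) ^ 3) + 1) ^ 3 *
        (∫ x, ‖BDSV.curl v x‖ ^ 4) ^ 6 * (∫ x, ‖BDSV.curl v x‖ ^ 2) ^ 5 *
          (∫ x, ‖BDSV.curl v x‖ ^ 2 * ∑ k, ‖partialDeriv k (BDSV.curl v) x‖ ^ 2) ^ 9 := by
  have hω : IsSmooth (BDSV.curl v) := BDSV.isSmooth_curl hv
  have hωc : Continuous (BDSV.curl v) := hω.continuous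
  have h0 : HasZeroMean (BDSV.curl v) := hasZeroMean_curl hv
  -- the quantities
  obtain ⟨X, hX⟩ : ∃ X : ℝ, X = ∫ x, torusVorticitySqAt v x * torusStretchingDensity v x := ⟨_, rfl⟩
  obtain ⟨A₄, hA₄⟩ : ∃ A : ℝ, A = ∫ x, ‖BDSV.curl v x‖ ^ 4 := ⟨_, rfl⟩
  obtain ⟨J, hJ⟩ : ∃ J : ℝ, J = ∫ x, torusVorticitySqAt v x * (∑ k, ‖partialDeriv k v x‖ ^ 2) ^ 2 :=
    ⟨_, rfl⟩
  obtain ⟨G₄, hG₄⟩ : ∃ G : ℝ, G = ∫ x, (∑ k, ‖partialDeriv k v x‖ ^ 2) ^ 4 := ⟨_, rfl⟩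
  obtain ⟨A₈, hA₈⟩ : ∃ A : ℝ, A = ∫ x, ‖BDSV.curl v x‖ ^ 8 := ⟨_, rfl⟩
  obtain ⟨A₁₂, hA₁₂⟩ : ∃ A : ℝ, A = ∫ x, ‖BDSV.curl v x‖ ^ 12 := ⟨_, rfl⟩
  obtain ⟨Z, hZ⟩ : ∃ Z : ℝ, Z = ∫ x, ‖BDSV.curl v x‖ ^ 2 := ⟨_, rfl⟩
  obtain ⟨I, hI⟩ : ∃ I : ℝ, I = ∫ x, ‖BDSV.curl v x‖ ^ 2 *
      ∑ k, ‖partialDeriv k (BDSV.curl v) x‖ ^ 2 := ⟨_, rfl⟩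
  -- `∫ |ω|⁴ = A₄` in the `torusVorticitySqAt` spelling
  have hA₄' : ∫ x, torusVorticitySqAt v x ^ 2 = A₄ := by
    rw [hA₄]
    exact integral_congr_ae (ae_of_all _ fun x => by
      show torusVorticitySqAt v x ^ 2 = ‖BDSV.curl v x‖ ^ 4
      rw [← norm_curl_sq]; ring)
  have hA₄0 : 0 ≤ A₄ := by rw [hA₄]; exact integral_nonneg fun x => by positivity
  have hG0 : 0 ≤ G₄ := by rw [hG₄]; exact integral_nonneg fun x => by positivity
  have hA₁₂0 : 0 ≤ A₁₂ := by rw [hA₁₂]; exact integral_nonneg fun x => by positivity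
  have hZ0 : 0 ≤ Z := by rw [hZ]; exact integral_nonneg fun x => by positivity
  have hI0 : 0 ≤ I := by rw [hI]; exact integral_nonneg fun x => by positivity
  -- the six inputs
  have h1 : |X| ^ 2 ≤ 2 * A₄ * J := by
    rw [sq_abs, hX, ← hA₄', hJ]; exact stretching_integral_sq_le hv
  have h2 : J ^ 2 ≤ A₄ * G₄ := by
    rw [hJ, ← hA₄', hG₄]; exact weighted_gradPow_sq_le hv
  have h3 : G₄ ≤ K * A₈ := by rw [hG₄, hA₈]; exact hK v hv hdiv
  have h4 : A₈ ^ 2 ≤ A₄ * A₁₂ := by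
    rw [hA₈, hA₄, hA₁₂]; exact VelocityL4.integral_norm_pow_eight_sq_le hωc
  have h5 : A₄ ^ 5 ≤ Z ^ 4 * A₁₂ := by
    rw [hA₄, hZ, hA₁₂]; exact integral_norm_pow_four_pow_five_le hωc
  have h6 : A₁₂ ≤ 32 * (64 * C₆ + (1968 * (3 : ℝ) ^ 3) ^ 3) * I ^ 3 := by
    have h := VelocityL4.integral_norm_pow_twelve_le hC₆0 hC₆ hω h0
    simp only [Fintype.card_fin, Nat.cast_ofNat] at h
    rw [hA₁₂, hI]; exact h
  have key := production_pow_fourteen_le hA₄0 hG0 hA₁₂0 hZ0 hI0 hK0 (by positivity)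
    h1 h2 h3 h4 h5 h6
  rw [hX, hA₄, hZ, hI] at key
  exact key

/-! ## 4. The `Z₄` balance at a time slice -/

/-- The forcing term of the vorticity balance vanishes for the unforced system. [folklore] -/
theorem sum_vorticityTensor_mul_curl_zero_force (v : UnitAddTorus d → EuclideanSpace ℝ d)
    (t : ℝ) (x : UnitAddTorus d) :
    ∑ i, ∑ j, torusVorticityTensor v i j x *
      (partialDeriv i ((0 : ℝ → UnitAddTorus d → EuclideanSpace ℝ d) t) x j -
        partialDeriv j ((0 : ℝ → UnitAddTorus d → EuclideanSpace ℝ d) t) x i) = 0 := by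
  have h0 : ∀ i, partialDeriv i (0 : UnitAddTorus d → EuclideanSpace ℝ d) x = 0 := by
    intro i
    simp [Torus.partialDeriv, Torus.lineDeriv]
  simp [h0]

/-- **Slice form of the exact `Z₄` balance on `T³`** (tree
`hasDerivWithinAt_integral_torusVorticitySqAt_pow`, `m = 2`, unforced; Gibbon 2010 App. A):
along a classical solution on `[a, b] × T³` with `ν ≥ 0`, `s ↦ ∫|ω(s)|⁴` is differentiable within
`[a, b]` at `t` and `d/dt ∫|ω|⁴ ≤ 4∫|ω|²σ − 4ν∫‖ω‖²∑ₖ‖∂ₖω‖²`, `ω = curl u(t)` (the second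
viscous term `−2ν∫∑ₖ(∂ₖ|ω|²)²` is dropped; the first is `VorticityL4.viscous_term_eq`).
[cite: Gibbon2010, Appendix A (proof of Prop. 1), opening identity] -/
theorem derivWithin_Z4_le {a b ν : ℝ} (hab : a < b) (hν : 0 ≤ ν)
    {u : ℝ → UnitAddTorus (Fin 3) → EuclideanSpace ℝ (Fin 3)} {p : ℝ → UnitAddTorus (Fin 3) → ℝ}
    (hsol : IsClassicalNSSolutionOn (Icc a b) ν 0 u p) {t : ℝ} (ht : t ∈ Icc a b) :
    DifferentiableWithinAt ℝ (fun s => ∫ x, torusVorticitySqAt (u s) x ^ 2) (Icc a b) t ∧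
      derivWithin (fun s => ∫ x, torusVorticitySqAt (u s) x ^ 2) (Icc a b) t ≤
        4 * (∫ x, torusVorticitySqAt (u t) x * torusStretchingDensity (u t) x) -
          4 * ν * ∫ x, ‖BDSV.curl (u t) x‖ ^ 2 * ∑ k, ‖partialDeriv k (BDSV.curl (u t)) x‖ ^ 2 := by
  have hut : IsSmooth (u t) := hsol.smooth_velocity.isSmooth_slice ht
  have hD := hsol.hasDerivWithinAt_integral_torusVorticitySqAt_pow hab 2 ht
  have hUD : UniqueDiffWithinAt ℝ (Icc a b) t := uniqueDiffOn_Icc hab t ht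
  refine ⟨hD.differentiableWithinAt, ?_⟩
  rw [hD.derivWithin hUD]
  obtain ⟨X, hX⟩ : ∃ X : ℝ, X = ∫ x, torusVorticitySqAt (u t) x * torusStretchingDensity (u t) x :=
    ⟨_, rfl⟩
  obtain ⟨I, hI⟩ : ∃ I : ℝ, I = ∫ x, ‖BDSV.curl (u t) x‖ ^ 2 *
      ∑ k, ‖partialDeriv k (BDSV.curl (u t)) x‖ ^ 2 := ⟨_, rfl⟩
  obtain ⟨I₂, hI₂⟩ : ∃ I₂ : ℝ, I₂ = ∫ x, torusVorticitySqAt (u t) x ^ (2 - 2) *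
      ∑ k, partialDeriv k (torusVorticitySqAt (u t)) x ^ 2 := ⟨_, rfl⟩
  have hI₂0 : 0 ≤ I₂ := by
    rw [hI₂]
    exact integral_nonneg fun x => mul_nonneg (pow_nonneg (torusVorticitySqAt_nonneg _ _) _)
      (Finset.sum_nonneg fun k _ => sq_nonneg _)
  have hV1 : ∫ x, torusVorticitySqAt (u t) x ^ (2 - 1) * ∑ k, ∑ i, ∑ j,
      partialDeriv k (torusVorticityTensor (u t) i j) x ^ 2 = 2 * I := by
    rw [hI, ← viscous_term_eq hut]
    exact integral_congr_ae (ae_of_all _ fun x => by simp)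
  have hS : ∫ x, torusVorticitySqAt (u t) x ^ (2 - 1) * torusStretchingDensity (u t) x = X := by
    rw [hX]; exact integral_congr_ae (ae_of_all _ fun x => by simp)
  have hf0 : ∫ x, torusVorticitySqAt (u t) x ^ (2 - 1) * ∑ i, ∑ j,
      torusVorticityTensor (u t) i j x *
        (partialDeriv i ((0 : ℝ → UnitAddTorus (Fin 3) → EuclideanSpace ℝ (Fin 3)) t) x j -
          partialDeriv j ((0 : ℝ → UnitAddTorus (Fin 3) → EuclideanSpace ℝ (Fin 3)) t) x i) = 0 := by
    simp only [sum_vorticityTensor_mul_curl_zero_force, mul_zero, integral_zero]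
  rw [hV1, hS, hf0, ← hI₂]
  push_cast
  have hνI₂ : 0 ≤ ν * I₂ := mul_nonneg hν hI₂0
  nlinarith [hνI₂]

/-! ## 5. The saturating law -/

/-- `Z₄` in the matrix's spelling: `torusVorticityMoment 4 v = ∫ (|ω|²)²`. [folklore] -/
theorem torusVorticityMoment_four (v : UnitAddTorus d → EuclideanSpace ℝ d) :
    torusVorticityMoment 4 v = ∫ x, torusVorticitySqAt v x ^ 2 := by
  unfold torusVorticityMoment
  refine integral_congr_ae (ae_of_all _ fun x => ?_)
  show torusVorticitySqAt v x ^ ((4 : ℝ) / 2) = torusVorticitySqAt v x ^ 2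
  rw [show (4 : ℝ) / 2 = ((2 : ℕ) : ℝ) by norm_num, Real.rpow_natCast]

/-- **K0 row `E.q=4|T_LD|G1` HOLDS (∃κ), in the kernel, on `T³ = UnitAddTorus (Fin 3)`.** There
is a constant `κ` such that along every zero-mean classical solution of the unforced Navier–Stokes
equations on `T³` (`ν > 0`), at every time of the window, `s ↦ Z₄(u(s)) = ∫|ω|⁴` is differentiable
within the window and `dZ₄/dt ≤ κ · ν^{−9/5} · (2ℰ) · Z₄^{1+1/5}` — the cell's saturating law
`T_LD` with `σ = 5`, `γ = 9/5` for the vorticity moment `Z₄` (`Candidates.SaturatingLaw`,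
`torusVorticityMoment 4`), the exponents of SIEVELD §3.2 (`σ = 2q−3`, `γ = (3q−3)/(2q−3)`,
`q = 4`). The constant is existential through the tree's mean-zero Sobolev constant and the
Calderón–Zygmund constant at `s = 8`; an a priori inequality, small-data closing only.
[ours; chain of SIEVELD §3.2 (`q = 4`) with tree inputs, cf. Gibbon2010 App. A] -/
theorem vorticityL4_saturatingLaw :
    ∃ κ : ℝ, SaturatingLaw (d := Fin 3) (torusVorticityMoment 4) 5 (9 / 5) κ := by
  obtain ⟨C₆, hC₆0, hC₆⟩ :=
    Torus.exists_integral_norm_pow_six_le_gradNormSq_cube (d := Fin 3) (by simp)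
  obtain ⟨K, hK0, hK⟩ := exists_integral_gradSq_pow_four_le
  obtain ⟨K', hK'⟩ : ∃ K' : ℝ, K' = 256 * (K + 1) ^ 4 *
      (32 * (64 * C₆ + (1968 * (3 : ℝ) ^ 3) ^ 3) + 1) ^ 3 := ⟨_, rfl⟩
  have hK'0 : 0 ≤ K' := by rw [hK']; positivity
  -- the rate constant: `κ = (10/7) (K' (9/14)⁹)^{1/5}`
  obtain ⟨c, hc⟩ : ∃ c : ℝ, c = (K' * (9 / 14) ^ 9) ^ (1 / 5 : ℝ) := ⟨_, rfl⟩
  have hc0 : 0 ≤ c := by rw [hc]; positivity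
  refine ⟨10 / 7 * c, ?_⟩
  intro _ ν hν a b hab u p hsol hmean t ht
  have hut : IsSmooth (u t) := hsol.smooth_velocity.isSmooth_slice ht
  have hdiv : IsDivFree (u t) := hsol.divFree t ht
  have hF : (fun s => torusVorticityMoment 4 (u s)) =
      fun s => ∫ x, torusVorticitySqAt (u s) x ^ 2 := by
    funext s; exact torusVorticityMoment_four (u s)
  obtain ⟨hdiff, hle⟩ := derivWithin_Z4_le hab hν.le hsol ht
  refine ⟨by rw [hF]; exact hdiff, ?_⟩
  rw [hF]
  show _ ≤ 10 / 7 * c * ν ^ (-(9 / 5 : ℝ)) * (2 * torusEnstrophy (u t)) *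
      (torusVorticityMoment 4 (u t)) ^ (1 + (5 : ℝ)⁻¹)
  -- opaque names for the slice quantities
  obtain ⟨X, hX⟩ : ∃ X : ℝ, X = ∫ x, torusVorticitySqAt (u t) x * torusStretchingDensity (u t) x :=
    ⟨_, rfl⟩
  obtain ⟨I, hI⟩ : ∃ I : ℝ, I = ∫ x, ‖BDSV.curl (u t) x‖ ^ 2 *
      ∑ k, ‖partialDeriv k (BDSV.curl (u t)) x‖ ^ 2 := ⟨_, rfl⟩
  obtain ⟨A₄, hA₄⟩ : ∃ A : ℝ, A = ∫ x, ‖BDSV.curl (u t) x‖ ^ 4 := ⟨_, rfl⟩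
  obtain ⟨Z, hZ⟩ : ∃ Z : ℝ, Z = ∫ x, ‖BDSV.curl (u t) x‖ ^ 2 := ⟨_, rfl⟩
  rw [← hX, ← hI] at hle
  have hI0 : 0 ≤ I := by rw [hI]; exact integral_nonneg fun x => by positivity
  have hA₄0 : 0 ≤ A₄ := by rw [hA₄]; exact integral_nonneg fun x => by positivity
  have hZ0 : 0 ≤ Z := by rw [hZ]; exact integral_nonneg fun x => by positivity
  -- `|X|¹⁴ ≤ K' A₄⁶ Z⁵ I⁹`
  have h14 : |X| ^ 14 ≤ K' * A₄ ^ 6 * Z ^ 5 * I ^ 9 := by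
    rw [hK', hX, hA₄, hZ, hI]
    exact production_bound hC₆0 hK0 hC₆ hK hut hdiv
  -- Young: `|X| ≤ (9/14) x + (5/14) y`, `x = (14/9) ν I`, `y = c ν^{-9/5} Z A₄^{6/5}`
  obtain ⟨x, hx⟩ : ∃ x : ℝ, x = 14 / 9 * ν * I := ⟨_, rfl⟩
  obtain ⟨y, hy⟩ : ∃ y : ℝ, y = c * ν ^ (-(9 / 5 : ℝ)) * Z * A₄ ^ (6 / 5 : ℝ) := ⟨_, rfl⟩
  have hx0 : 0 ≤ x := by rw [hx]; positivity
  have hνr : 0 ≤ ν ^ (-(9 / 5 : ℝ)) := Real.rpow_nonneg hν.le _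
  have hy0 : 0 ≤ y := by rw [hy]; positivity
  have hxy : x ^ 9 * y ^ 5 = K' * A₄ ^ 6 * Z ^ 5 * I ^ 9 := by
    have e1 : c ^ 5 = K' * (9 / 14) ^ 9 := by
      rw [hc, ← Real.rpow_natCast, ← Real.rpow_mul (by positivity)]; norm_num
    have e2 : (ν ^ (-(9 / 5 : ℝ))) ^ 5 = (ν ^ 9)⁻¹ := by
      rw [← Real.rpow_natCast, ← Real.rpow_mul hν.le,
        show (-(9 / 5 : ℝ)) * ((5 : ℕ) : ℝ) = -((9 : ℕ) : ℝ) by norm_num,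
        Real.rpow_neg hν.le, Real.rpow_natCast]
    have e3 : (A₄ ^ (6 / 5 : ℝ)) ^ 5 = A₄ ^ 6 := by
      rw [← Real.rpow_natCast, ← Real.rpow_mul hA₄0,
        show (6 / 5 : ℝ) * ((5 : ℕ) : ℝ) = ((6 : ℕ) : ℝ) by norm_num, Real.rpow_natCast]
    have hν9 : ν ^ 9 ≠ 0 := pow_ne_zero 9 hν.ne'
    rw [hx, hy]
    simp only [mul_pow]
    rw [e1, e2, e3]
    field_simp
  have hNle : |X| ≤ 9 / 14 * x + 5 / 14 * y :=
    le_of_pow_fourteen_le (abs_nonneg X) hx0 hy0 (by rw [hxy]; exact h14)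
  -- the budget in closed form
  have hbudget : 10 / 7 * c * ν ^ (-(9 / 5 : ℝ)) * (2 * torusEnstrophy (u t)) *
      (torusVorticityMoment 4 (u t)) ^ (1 + (5 : ℝ)⁻¹) = 10 / 7 * y := by
    have e1 : 2 * torusEnstrophy (u t) = Z := by
      rw [hZ, ← integral_torusVorticitySqAt_eq_two_mul_torusEnstrophy hut hdiv]
      exact integral_congr_ae (ae_of_all _ fun x => (norm_curl_sq (u t) x).symm)
    have e2 : torusVorticityMoment 4 (u t) = A₄ := by
      rw [torusVorticityMoment_four, hA₄]
      exact integral_congr_ae (ae_of_all _ fun x => by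
        show torusVorticitySqAt (u t) x ^ 2 = ‖BDSV.curl (u t) x‖ ^ 4
        rw [← norm_curl_sq]; ring)
    rw [e1, e2, show (1 : ℝ) + (5 : ℝ)⁻¹ = 6 / 5 by norm_num, hy]
    ring
  rw [hbudget]
  have hXle : X ≤ |X| := le_abs_self X
  have hxI : 9 / 14 * x = ν * I := by rw [hx]; ring
  nlinarith [hNle, hXle, hxI, hle, hy0]

end VorticityL4

end Summit.NavierStokesRegularity.FunctionalMining
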